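import Literature.NumberTheory.EllipticCurves.CasselsTateSelmerKolyvaginValue
import Literature.NumberTheory.EllipticCurves.SelmerGaloisActionPlaces
import Summits.BirchSwinnertonDyer.BirchSwinnertonDyer.Theorems.GenusKolyvaginAtTwoPowDvdShaCardAtTwoRTBottomRungEngineDeep
import HarnessLib

/-!
# Route `GenusKolyvaginAtTwo`, crux L_T `PowDvdShaCardAtTwoRT` (stmt-BirchSwinnertonDyer-23299), LINE 18, road (E4) — socket X-ORTH, naturality:
# `σ_*` commutes with the level change `[k]_* : H¹(·, E[kd]) → H¹(·, E[d])` LOCALLY (`localConjH1` / `conjActPlace`), and the `τ`-sign of a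
# level-`m` Selmer preimage `b′` is that of `ι_* b′`

Seat `bsd-line-gk2-p4` g20 (WIDTH-5 attach, cell `bsd-f1-sign2`), `--supports` the crux L_T (helper; closes nothing).  THEOREMS ONLY (no
definition, no named fact, no `sorry`); BSD is not proved by any of this; neither is L_T nor any stub.

WHY (memo `Cruxes/PowDvdShaCardAtTwoRT/Lines/plus-descent-deep-orthogonality-gk2p4.md` §7, `…RTCrossPairVanishing` §3).  The CROSS local term
of McCallum's Prop. 4.7 vanishes (`firstCase_localTerm_eq_zero_of_cross`) once the Kummer lift `β′_λ` of a first-case datum is known to be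
`(−s)`-eigen MODULO `m·𝓛_λ` and the global lift `b₁` is `s`-eigen.  The datum only records `mulK β′_λ = loc_λ b′` and `ι_* b′ = t`; turning the sign
of `t` (a Kolyvagin class, `sign_conjAct_kolyvaginClass_two`) into these clauses needs that `σ_*` commutes with the two level changes:
* §1 `localConjH1_map_mulK` — **`σ_* ([k]_* y) = [k]_* (σ_* y)`** on `H¹(Γ_E, E[kd])` for the local action `localConjH1` of an adapted pair of lifts
  (both sides are `[g ↦ k·τψ(Θ⁻¹gΘ)]` on cocycles; `τ` is additive on points); `conjActPlace_map_mulK` — the same for `σ_* = conjActPlace` at finite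
  places `v ↦ σv` of a number field.  Hence `conjActPlace_map_mulK_of_eigen`: if `σ_*(loc b′) = ε·loc b′` then
  `[m]_*(σ_*β′ − ε·β′) = 0` for every lift `β′` of `loc b′` along `[m]_*` — the shape `…CrossPairVanishing` §3 consumes modulo the Kummer kernel fact
  `ker [m]_* ∩ 𝓛^{(m²)} = m·𝓛^{(m²)}` (next file).
* §2 `conjAct_eq_smul_of_map_inclKD_eq` — **the sign of `b′` is the sign of `ι_* b′`**: `ι_* b′ = t`, `τ_* t = ε·t`, `E(K)[m] = 0` ⟹ `τ_* b′ = ε·b′`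
  (`RelaxedCount.conjAct_torsionH1OfDvd` + injectivity of `ι_*`, `map_inclKD_injective_of_forall_fixed_eq_zero`).

References: [SerreGaloisCohomology1997] I §2.4 (compatible pairs), §5.8; [McCallumLMS1991] §4 Prop. 4.7; [MilneADT2006] I §6 proof of Prop. 6.9.
-/

set_option autoImplicit false

noncomputable section

open scoped Classical
open Function Field NumberField IsDedekindDomain WeierstrassCurve
open Literature.NumberTheory.EllipticCurves Literature.NumberTheory.GaloisRepresentations
open Literature.NumberTheory.GaloisCohomology
open Literature.NumberTheory.Automorphic

-- the Theorems namespace of this sub repeats the summit name by design (D-0017 nested layout)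
set_option linter.dupNamespace false

universe u

namespace Summit.BirchSwinnertonDyer.BirchSwinnertonDyer.Theorems.GenusExact.PlusDescent

/-! ## §1 `σ_*` commutes with `[k]_*` locally -/

section Local

variable {K : Type u} [Field K] [CharZero K] (W : WeierstrassCurve ℚ)
variable {E E' : Type u} [Field E] [Algebra K E] [Field E'] [Algebra K E']
variable {σ : K ≃ₐ[ℚ] K} {τ : AlgebraicClosure K ≃+* AlgebraicClosure K} {θ : E ≃+* E'}
  {Θ : AlgebraicClosure E ≃+* AlgebraicClosure E'}

/-- **`σ_* ∘ [k]_* = [k]_* ∘ σ_*` on `H¹(Γ_E, E[kd])`** for the local action `localConjH1` of an adapted pair of lifts `(τ, Θ)` and the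
multiplication `[k] : E[kd] → E[d]` (`mulK`): on a cocycle `ψ` both sides are `g ↦ k·τψ(Θ⁻¹gΘ)`, because `τ` acts additively on points.
[cite: SerreGaloisCohomology1997, I §2.4] -/
theorem localConjH1_map_mulK (hτ : IsLiftOfAut σ τ) (hΘ : IsLiftOfRingEquiv θ Θ) (hc : LiftsCommute τ Θ) (k d : ℕ)
    (y : galoisCohomology (GaloisRep.restrictField E ((W.baseChange K).torsionGaloisModule ((k * d : ℕ) : ℤ))) 1) :
    localConjH1 W hτ hΘ hc (d : ℤ) (galoisCohomology.map ((mulK (W.baseChange K) k d).restrictField E) 1 y) =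
      galoisCohomology.map ((mulK (W.baseChange K) k d).restrictField E') 1 (localConjH1 W hτ hΘ hc ((k * d : ℕ) : ℤ) y) := by
  obtain ⟨ψ, rfl⟩ := oneCocycleClass_surjective _ y
  rw [galoisCohomology.map_one_oneCocycleClass, localConjH1_oneCocycleClass, localConjH1_oneCocycleClass,
    galoisCohomology.map_one_oneCocycleClass]
  congr 1
  apply Subtype.ext
  apply ContinuousMap.ext
  intro g
  rw [contOneCocycles.pullback_apply, contOneCocycles.pullback_apply, contOneCocycles.pullback_apply,
    contOneCocycles.pullback_apply]
  change hτ.torsionMap W (d : ℤ) (mulK (W.baseChange K) k d (ψ.1 (hΘ.conjGalCMH g))) =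
    mulK (W.baseChange K) k d (hτ.torsionMap W ((k * d : ℕ) : ℤ) (ψ.1 (hΘ.conjGalCMH g)))
  apply Subtype.ext
  rw [IsLiftOfAut.coe_torsionMap, coe_mulK_apply, coe_mulK_apply, IsLiftOfAut.coe_torsionMap, map_zsmul]

end Local

section Places

variable {K : Type} [Field K] [NumberField K] (W : WeierstrassCurve ℚ) (σ : K ≃ₐ[ℚ] K)

/-- **`σ_* ∘ [k]_* = [k]_* ∘ σ_*` at finite places**: for `σ v = w`, `conjActPlace` (level `d`) of `[k]_* X` is `[k]_*` of `conjActPlace`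
(level `kd`) of `X`, `X ∈ H¹(K_v, E[kd])`. [cite: SerreGaloisCohomology1997, I §2.4] [cite: Jetchev2008, §5 Thm. 5.1] -/
theorem conjActPlace_map_mulK {v w : HeightOneSpectrum (𝓞 K)} (h : σ • v = w) (k d : ℕ)
    (X : galoisCohomology (((W.baseChange K).torsionGaloisModule ((k * d : ℕ) : ℤ)).toLocal (Sum.inr v : Place K)) 1) :
    conjActPlace W σ (d : ℤ) h
        (galoisCohomology.map ((mulK (W.baseChange K) k d).restrictField (Place.Completion (Sum.inr v : Place K))) 1 X) =
      galoisCohomology.map ((mulK (W.baseChange K) k d).restrictField (Place.Completion (Sum.inr w : Place K))) 1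
        (conjActPlace W σ ((k * d : ℕ) : ℤ) h X) :=
  localConjH1_map_mulK W (isLiftOfAut_liftAutPlace σ h)
    (isLiftOfRingEquiv_ringEquivLift (galAdicCompletionEquiv (L := K) σ h)) (liftsCommute_liftAutPlace σ h) k d X

/-- **The lift `β′` of an `ε`-eigen class is `ε`-eigen modulo `ker [k]_*`.**  At a `σ`-fixed finite place `v`, if `Y = [k]_* β′` (levels `kd → d`)
satisfies `σ_* Y = ε·Y`, then `[k]_*(σ_*β′ − ε·β′) = 0`. (For `β′` in the Kummer condition `𝓛^{(kd)}` the kernel of `[k]_*` there is `k·𝓛^{(kd)}`,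
so `σ_*β′ − ε·β′ ∈ k·𝓛^{(kd)}` — the clause of `firstCase_localTerm_eq_zero_of_cross`.) [cite: McCallumLMS1991, §4 Prop. 4.7]
[cite: SerreGaloisCohomology1997, I §2.4] -/
theorem map_mulK_conjActPlace_sub_smul_eq_zero {v : HeightOneSpectrum (𝓞 K)} (h : σ • v = v) (k d : ℕ) {ε : ℤ}
    (β' : galoisCohomology (((W.baseChange K).torsionGaloisModule ((k * d : ℕ) : ℤ)).toLocal (Sum.inr v : Place K)) 1)
    (hY : conjActPlace W σ (d : ℤ) h
        (galoisCohomology.map ((mulK (W.baseChange K) k d).restrictField (Place.Completion (Sum.inr v : Place K))) 1 β') =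
      ε • galoisCohomology.map ((mulK (W.baseChange K) k d).restrictField (Place.Completion (Sum.inr v : Place K))) 1 β') :
    (galoisCohomology.map ((mulK (W.baseChange K) k d).restrictField (Place.Completion (Sum.inr v : Place K))) 1 :
        galoisCohomology (((W.baseChange K).torsionGaloisModule ((k * d : ℕ) : ℤ)).toLocal (Sum.inr v : Place K)) 1 →+
          galoisCohomology (((W.baseChange K).torsionGaloisModule (d : ℤ)).toLocal (Sum.inr v : Place K)) 1)
      (conjActPlace W σ ((k * d : ℕ) : ℤ) h β' - ε • β') = 0 := by
  set F : galoisCohomology (((W.baseChange K).torsionGaloisModule ((k * d : ℕ) : ℤ)).toLocal (Sum.inr v : Place K)) 1 →+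
      galoisCohomology (((W.baseChange K).torsionGaloisModule (d : ℤ)).toLocal (Sum.inr v : Place K)) 1 :=
    galoisCohomology.map ((mulK (W.baseChange K) k d).restrictField (Place.Completion (Sum.inr v : Place K))) 1 with hF
  have h1 : conjActPlace W σ (d : ℤ) h (F β') = F (conjActPlace W σ ((k * d : ℕ) : ℤ) h β') :=
    conjActPlace_map_mulK W σ h k d β'
  have hY' : conjActPlace W σ (d : ℤ) h (F β') = ε • F β' := hY
  have e1 := F.map_sub (conjActPlace W σ ((k * d : ℕ) : ℤ) h β') (ε • β')
  have e2 : F (ε • β') = ε • F β' := map_zsmul F ε β'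
  rw [e2, ← h1, hY', sub_self] at e1
  exact e1

end Places

/-! ## §2 The sign of the level-`m` preimage -/

section Sign

variable {K : Type} [Field K] [NumberField K] (W : WeierstrassCurve ℚ) (τ : K ≃ₐ[ℚ] K) (m : ℕ)

/-- **`ι_*` reflects `τ_*`-signs**: if `ι_* b′ = t` (`ι : E[m] ↪ E[m·m]`), `τ_* t = ε·t` and `E[m]` has no non-zero `Γ_K`-fixed point (so that `ι_*`
is injective, `map_inclKD_injective_of_forall_fixed_eq_zero`), then `τ_* b′ = ε·b′` — `τ_*` commutes with `ι_*`
(`RelaxedCount.conjAct_torsionH1OfDvd`). [cite: SerreGaloisCohomology1997, I §2.4 and §5.8] -/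
theorem conjAct_eq_smul_of_map_inclKD_eq [NeZero m]
    (hfix : ∀ P : geomTorsion (W.baseChange K) (m : ℤ), (∀ g : absoluteGaloisGroup K, g • P = P) → P = 0)
    {b' : galoisCohomology ((W.baseChange K).torsionGaloisModule (m : ℤ)) 1}
    {t : galoisCohomology ((W.baseChange K).torsionGaloisModule ((m * m : ℕ) : ℤ)) 1} {ε : ℤ}
    (hι : galoisCohomology.map (inclKD (W.baseChange K) m m) 1 b' = t) (ht : conjAct W τ ((m * m : ℕ) : ℤ) t = ε • t) :
    conjAct W τ (m : ℤ) b' = ε • b' := by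
  apply map_inclKD_injective_of_forall_fixed_eq_zero (W.baseChange K) m hfix
  have key := RelaxedCount.conjAct_torsionH1OfDvd W τ (n := ((m * m : ℕ) : ℤ))
    (Int.natCast_dvd_natCast.mpr (dvd_mul_left m m)) b'
  rw [map_zsmul, hι, ← ht, ← hι, map_torsionInclusion_one_apply, map_torsionInclusion_one_apply]
  exact key.symm

end Sign

end Summit.BirchSwinnertonDyer.BirchSwinnertonDyer.Theorems.GenusExact.PlusDescent

end
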